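import Summits.ResolutionOfSingularities.ResolutionOfSingularities.Theses.MaxContactCut
import Summits.ResolutionOfSingularities.ResolutionOfSingularities.Theorems.SurfaceShadowClasses
import Summits.ResolutionOfSingularities.ResolutionOfSingularities.Theorems.SurfaceShadowKernels
import Summits.ResolutionOfSingularities.ResolutionOfSingularities.Theorems.MaxContactCutMonomialTowers
import Summits.ResolutionOfSingularities.ResolutionOfSingularities.Theorems.MaxContactCutHugDimension
import HarnessLib

/-!
# MaxContactCutSurfaceShadow — the g11 node «SurfaceShadow» wired to the route MaxContactCut BY NAME
(decomp-res node N55, lens-4 g11 sha256 9b3c91692c4a9373; CRITIC-LEDGER row 70 CLEARED AS CARVE NODE; phase 3 of 3)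

Vocabulary, ports and the paper proof of the SURFACE LAW: `Theorems/SurfaceShadowClasses`; proved kernels:
`Theorems/SurfaceShadowKernels`.  Route asides (MaxContactCut, `aside · rank 9`, refining the tower residual
`NoHuggingTowers` 31570 below the g10 re-cut `NoNonMonomialTowers` 32201 / `NoSurfaceHuggingTowers` 32203):
`NoRegularSurfaceHuggingTowers` [DECIDED-MOD-PORT by the prover item `SurfaceLawAll` — the SURFACE LAW: no infinite
forced tower hugs a REGULAR surface germ, all `k`, `p`, `d`], `NoTwoEternalTowers` [corollary, COSTUME(snc bookkeeping):
at most ONE eternal own component], `NoSingularSurfaceHuggingTowers` [THE LOCATED RESIDUAL of the `w = 2` leaf: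
UNDECIDED · ATTACKABLE · INSTRUMENTABLE], `NoRoughTowers` [THE LOCATED RESIDUAL OF THE TOWER SIDE AFTER g11 =
singular-surface leaf ∧ hypersurface leaf 32204, ≡ 31570 modulo decided pieces], `SurfaceLawAll` [port = prover target].

Kernels (all by name, 0 sorry): the asides unfolded; 32203 ⟸ `SurfaceLawAll` ∧ singular-surface leaf and the EXACT
re-cuts one item up (`noSurfaceHuggingTowers_iff`, `noNonMonomialTowers_iff_rough`); 31570 from the g10/g11 ports and
the two residual leaves (`noHuggingTowers_of_g11`) or from `NoRoughTowers` (`noHuggingTowers_of_rough`); necessity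
port-free (`pieces_of_noHuggingTowers`, `pieces_of_noForcedTowers`); 30253 EXACTLY (`noForcedTowers_iff_g11_leaves`);
`RungOne` 29273 and the located core 28544 through the TREE kernels of `MaxContactCutMonomialTowers`.  ROOT BY NAME is
the route's `closes`.  WHY THIS IS NOVEL (critic row 70): the `w = 2` leaf is cut by the MULTIPLICITY of the hugged
surface germ and multiplicity one is decided for every residue field by a closure-normalised two-dimensional SHADOW
(Zariski–Lipman complete ideals + Hoskin–Deligne colength drop) ending in an elementary corner descent — the bed of
nails lives in singular hugged surfaces and hugged hypersurfaces only.  (Sources: HunekeSwanson2006 ch. 14;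
Matsumura1987 §§22–23; CossartJannsenSaito2020 Thm 6.35 / 6.40; Hauser2010.)
-/

set_option autoImplicit false

namespace Summit.ResolutionOfSingularities.ResolutionOfSingularities.Theorems.MaxContactCutSurfaceShadow

open CategoryTheory AlgebraicGeometry
open Literature.AlgebraicGeometry.Resolution
open Summit.ResolutionOfSingularities.ResolutionOfSingularities.Theses
open Summit.ResolutionOfSingularities.ResolutionOfSingularities.Theorems
open WeakOrderReduction ForcedTowerClasses DivergentTowerClasses MonomialTowerClasses
open HugDimensionClasses HugDimensionKernels SurfaceShadowClasses SurfaceShadowKernels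

/-! ## The asides unfolded -/

/-- `NoRegularSurfaceHuggingTowers` is the regular-surface piece at every marking. [folklore] -/
theorem noRegularSurfaceHuggingTowers_iff :
    MaxContactCut.NoRegularSurfaceHuggingTowers ↔ ∀ n : ℕ, 1 ≤ n → RegularSurfaceHuggingTowersTerminate n := Iff.rfl

/-- `NoTwoEternalTowers` is the two-eternal-components piece at every marking. [folklore] -/
theorem noTwoEternalTowers_iff :
    MaxContactCut.NoTwoEternalTowers ↔ ∀ n : ℕ, 1 ≤ n → TwoEternalTowersTerminate n := Iff.rfl

/-- `NoSingularSurfaceHuggingTowers` is the located residual of the `w = 2` leaf at every marking. [folklore] -/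
theorem noSingularSurfaceHuggingTowers_iff :
    MaxContactCut.NoSingularSurfaceHuggingTowers ↔ ∀ n : ℕ, 1 ≤ n → SingularSurfaceHuggingTowersTerminate n :=
  Iff.rfl

/-- `NoRoughTowers` is the located residual of the tower side after g11 at every marking. [folklore] -/
theorem noRoughTowers_iff : MaxContactCut.NoRoughTowers ↔ ∀ n : ℕ, 1 ≤ n → RoughTowersTerminate n := Iff.rfl

/-- `SurfaceLawAll` is the SURFACE LAW port at every marking. [folklore] -/
theorem surfaceLawAll_iff : MaxContactCut.SurfaceLawAll ↔ ∀ n : ℕ, 1 ≤ n → SurfaceLaw n := Iff.rfl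

/-! ## The g11 pieces against the g10 asides (EXACT re-cuts one item up) -/

/-- **32203 `NoSurfaceHuggingTowers` ⟺ (regular part, decided) ∧ `NoSingularSurfaceHuggingTowers`** — the EXACT re-cut
of the `w = 2` leaf. [folklore] -/
theorem noSurfaceHuggingTowers_iff :
    MaxContactCut.NoSurfaceHuggingTowers ↔
      (∀ n : ℕ, 1 ≤ n → NoTower n (fun T =>
          (¬ EventuallyMonomial T ∧ ¬ CurveHugging T ∧ SurfaceHugging T) ∧ RegularSurfaceHugging T)) ∧
        MaxContactCut.NoSingularSurfaceHuggingTowers :=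
  ⟨fun h => ⟨fun n hn => (surfaceLeaf_iff.mp (h n hn)).1, fun n hn => (surfaceLeaf_iff.mp (h n hn)).2⟩,
    fun h n hn => surfaceLeaf_iff.mpr ⟨h.1 n hn, h.2 n hn⟩⟩

/-- **32203 from `SurfaceLawAll` and the singular-surface leaf.** [folklore] -/
theorem noSurfaceHuggingTowers_of_surfaceLaw (hL : MaxContactCut.SurfaceLawAll)
    (hS : MaxContactCut.NoSingularSurfaceHuggingTowers) : MaxContactCut.NoSurfaceHuggingTowers :=
  fun n hn => surfaceLeaf_of_surfaceLaw (hL n hn) (hS n hn)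

/-- Necessity, port-free: 32203 implies the singular-surface leaf. [folklore] -/
theorem noSingularSurfaceHuggingTowers_of_noSurfaceHuggingTowers (h : MaxContactCut.NoSurfaceHuggingTowers) :
    MaxContactCut.NoSingularSurfaceHuggingTowers :=
  (noSurfaceHuggingTowers_iff.mp h).2

/-- **EXACT: 32203 ⟺ `NoSingularSurfaceHuggingTowers` modulo `SurfaceLawAll`.** [folklore] -/
theorem noSurfaceHuggingTowers_iff_singular (hL : MaxContactCut.SurfaceLawAll) :
    MaxContactCut.NoSurfaceHuggingTowers ↔ MaxContactCut.NoSingularSurfaceHuggingTowers :=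
  ⟨noSingularSurfaceHuggingTowers_of_noSurfaceHuggingTowers, noSurfaceHuggingTowers_of_surfaceLaw hL⟩

/-- **32201 `NoNonMonomialTowers` ⟺ (regular part, decided) ∧ `NoRoughTowers`** — the EXACT re-cut of the g10
residual. [folklore] -/
theorem noNonMonomialTowers_iff_rough :
    MaxContactCut.NoNonMonomialTowers ↔
      (∀ n : ℕ, 1 ≤ n → NoTower n (fun T => ¬ EventuallyMonomial T ∧ RegularSurfaceHugging T)) ∧
        MaxContactCut.NoRoughTowers :=
  ⟨fun h => ⟨fun n hn => (nonMonomial_iff_rough.mp (h n hn)).1, fun n hn => (nonMonomial_iff_rough.mp (h n hn)).2⟩,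
    fun h n hn => nonMonomial_iff_rough.mpr ⟨h.1 n hn, h.2 n hn⟩⟩

/-- **32201 from `SurfaceLawAll` and `NoRoughTowers`.** [folklore] -/
theorem noNonMonomialTowers_of_rough (hL : MaxContactCut.SurfaceLawAll) (hR : MaxContactCut.NoRoughTowers) :
    MaxContactCut.NoNonMonomialTowers :=
  fun n hn => nonMonomial_of_g11 (regularSurface_of_surfaceLaw (hL n hn)) (hR n hn)

/-- **EXACT: 32201 ⟺ `NoRoughTowers` modulo `SurfaceLawAll`.** [folklore] -/
theorem noNonMonomialTowers_iff_noRoughTowers (hL : MaxContactCut.SurfaceLawAll) :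
    MaxContactCut.NoNonMonomialTowers ↔ MaxContactCut.NoRoughTowers :=
  ⟨fun h => (noNonMonomialTowers_iff_rough.mp h).2, noNonMonomialTowers_of_rough hL⟩

/-- **`NoRoughTowers` ⟺ (curve part) ∧ `NoSingularSurfaceHuggingTowers` ∧ 32204 `NoHypersurfaceHuggingTowers`**, and
from 32202 / the two leaves. [folklore] -/
theorem noRoughTowers_of_leaves (hC : MaxContactCut.NoCurveHuggingTowers)
    (hS : MaxContactCut.NoSingularSurfaceHuggingTowers) (hH : MaxContactCut.NoHypersurfaceHuggingTowers) :
    MaxContactCut.NoRoughTowers :=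
  fun n hn => rough_of_leaves (hC n hn) (hS n hn) (hH n hn)

/-- Necessity, port-free: `NoRoughTowers` implies the singular-surface and hypersurface leaves. [folklore] -/
theorem leaves_of_noRoughTowers (h : MaxContactCut.NoRoughTowers) :
    MaxContactCut.NoSingularSurfaceHuggingTowers ∧ MaxContactCut.NoHypersurfaceHuggingTowers :=
  ⟨fun n hn => (rough_iff_leaves.mp (h n hn)).2.1, fun n hn => (rough_iff_leaves.mp (h n hn)).2.2⟩

/-- **The decided piece from its port: `SurfaceLawAll → NoRegularSurfaceHuggingTowers`.** [folklore] -/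
theorem noRegularSurfaceHuggingTowers_of_surfaceLaw (hL : MaxContactCut.SurfaceLawAll) :
    MaxContactCut.NoRegularSurfaceHuggingTowers :=
  fun n hn => regularSurface_of_surfaceLaw (hL n hn)

/-- **`NoTwoEternalTowers` from the ports** (`TwoEternalSurface` snc bookkeeping + SURFACE LAW + curve law). [folklore] -/
theorem noTwoEternalTowers_of_ports (hT : ∀ n : ℕ, 1 ≤ n → TwoEternalSurface n) (hL : MaxContactCut.SurfaceLawAll)
    (hC : MaxContactCut.CurveLawAll) : MaxContactCut.NoTwoEternalTowers :=
  fun n hn => twoEternal_of_ports (hT n hn) (hL n hn) (hC n hn)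

/-! ## Up to the booked MaxContactCut items BY NAME (the lens §6) -/
/-- **THE TARGET 31570 `MaxContactCut.NoHuggingTowers` BY NAME from the ports and the two residual leaves.**
[folklore] -/
theorem noHuggingTowers_of_g11 (hM : MaxContactCut.MonomialCornerAll) (hK : NoCornerTowers)
    (hC : MaxContactCut.CurveLawAll) (hL : MaxContactCut.SurfaceLawAll)
    (hS : MaxContactCut.NoSingularSurfaceHuggingTowers) (hH : MaxContactCut.NoHypersurfaceHuggingTowers) :
    MaxContactCut.NoHuggingTowers :=
  fun n hn => hugging_of_g11 (hM n hn) (hK n hn) (hC n hn) (hL n hn) (hS n hn) (hH n hn)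

/-- **31570 from the ports and the g11 RESIDUAL `MaxContactCut.NoRoughTowers`.** [folklore] -/
theorem noHuggingTowers_of_rough (hM : MaxContactCut.MonomialCornerAll) (hK : NoCornerTowers)
    (hL : MaxContactCut.SurfaceLawAll) (hR : MaxContactCut.NoRoughTowers) : MaxContactCut.NoHuggingTowers :=
  fun n hn => hugging_of_monomial_nonMonomial (monomial_of_ports (hM n hn) (hK n hn))
    (nonMonomial_of_g11 (regularSurface_of_surfaceLaw (hL n hn)) (hR n hn))

/-- 31570 from the landed g10 wiring: `NoRoughTowers` + `SurfaceLawAll` give 32201, then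
`MaxContactCutHugDimension.noHuggingTowers_of_pieces`. [folklore] -/
theorem noHuggingTowers_of_rough' (hM : MaxContactCut.MonomialCornerAll) (hK : NoCornerTowers)
    (hL : MaxContactCut.SurfaceLawAll) (hR : MaxContactCut.NoRoughTowers) : MaxContactCut.NoHuggingTowers :=
  MaxContactCutHugDimension.noHuggingTowers_of_pieces hM hK (noNonMonomialTowers_of_rough hL hR)

/-- Necessity, port-free: 31570 implies the g11 decided piece and the singular-surface leaf. [folklore] -/
theorem pieces_of_noHuggingTowers (h : MaxContactCut.NoHuggingTowers) :
    MaxContactCut.NoRegularSurfaceHuggingTowers ∧ MaxContactCut.NoSingularSurfaceHuggingTowers :=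
  ⟨fun n hn => (pieces_of_hugging (h n hn)).1, fun n hn => (pieces_of_hugging (h n hn)).2.1⟩

/-- Necessity, port-free: 30253 implies every g11 piece. [folklore] -/
theorem pieces_of_noForcedTowers (h : MaxContactCut.NoForcedTowers) :
    MaxContactCut.NoRegularSurfaceHuggingTowers ∧ MaxContactCut.NoTwoEternalTowers ∧
      MaxContactCut.NoSingularSurfaceHuggingTowers ∧ MaxContactCut.NoRoughTowers ∧
        MaxContactCut.NoHypersurfaceHuggingTowers :=
  ⟨fun n hn => (SurfaceShadowKernels.pieces_of_ftt (h n hn)).1,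
    fun n hn => (SurfaceShadowKernels.pieces_of_ftt (h n hn)).2.1,
    fun n hn => (SurfaceShadowKernels.pieces_of_ftt (h n hn)).2.2.1,
    fun n hn => (SurfaceShadowKernels.pieces_of_ftt (h n hn)).2.2.2.1,
    fun n hn => (SurfaceShadowKernels.pieces_of_ftt (h n hn)).2.2.2.2⟩

/-- **30253 `MaxContactCut.NoForcedTowers` BY NAME** through the TREE kernel `noForcedTowers_of_pieces`
(tree port aside 31573 + 31570 from the g11 node). [folklore] -/
theorem noForcedTowers_of_g11 (hN : MaxContactCut.CornerNormalFormAll) (hM : MaxContactCut.MonomialCornerAll)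
    (hK : NoCornerTowers) (hC : MaxContactCut.CurveLawAll) (hL : MaxContactCut.SurfaceLawAll)
    (hS : MaxContactCut.NoSingularSurfaceHuggingTowers) (hH : MaxContactCut.NoHypersurfaceHuggingTowers) :
    MaxContactCut.NoForcedTowers :=
  MaxContactCutMonomialTowers.noForcedTowers_of_pieces hN (noHuggingTowers_of_g11 hM hK hC hL hS hH)

/-- 30253 WITHOUT the tree port 31573: the g10/g11 ports already give the tower piece (`ftt_iff_g11_leaves`).
[folklore] -/
theorem noForcedTowers_of_g11' (hM : MaxContactCut.MonomialCornerAll) (hK : NoCornerTowers)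
    (hC : MaxContactCut.CurveLawAll) (hL : MaxContactCut.SurfaceLawAll)
    (hS : MaxContactCut.NoSingularSurfaceHuggingTowers) (hH : MaxContactCut.NoHypersurfaceHuggingTowers) :
    MaxContactCut.NoForcedTowers :=
  fun n hn => (ftt_iff_g11_leaves (hM n hn) (hK n hn) (hC n hn) (hL n hn)).mpr ⟨hS n hn, hH n hn⟩

/-- **EXACT one item up, modulo the decided pieces: `MaxContactCut.NoForcedTowers ⟺ singular-surface leaf ∧
hypersurface leaf`.** [folklore] -/
theorem noForcedTowers_iff_g11_leaves (hM : MaxContactCut.MonomialCornerAll) (hK : NoCornerTowers)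
    (hC : MaxContactCut.CurveLawAll) (hL : MaxContactCut.SurfaceLawAll) :
    MaxContactCut.NoForcedTowers ↔
      MaxContactCut.NoSingularSurfaceHuggingTowers ∧ MaxContactCut.NoHypersurfaceHuggingTowers :=
  ⟨fun h => ⟨(pieces_of_noForcedTowers h).2.2.1, (pieces_of_noForcedTowers h).2.2.2.2⟩,
    fun h => noForcedTowers_of_g11' hM hK hC hL h.1 h.2⟩

/-- **EXACT: 30253 ⟺ `NoRoughTowers` modulo the decided pieces** (through 32201 and the landed
`MaxContactCutHugDimension.noForcedTowers_iff_nonMonomial`). [folklore] -/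
theorem noForcedTowers_iff_noRoughTowers (hM : MaxContactCut.MonomialCornerAll) (hK : NoCornerTowers)
    (hL : MaxContactCut.SurfaceLawAll) : MaxContactCut.NoForcedTowers ↔ MaxContactCut.NoRoughTowers :=
  (MaxContactCutHugDimension.noForcedTowers_iff_nonMonomial hM hK).trans (noNonMonomialTowers_iff_noRoughTowers hL)

/-- **RungOne (29273) BY NAME** through the TREE kernel `rungOne_of_pieces`. [folklore] -/
theorem rungOne_of_g11 (hSeed : ∀ n : ℕ, 1 ≤ n → ForcedSeed n) (hDesc : ∀ n : ℕ, 1 ≤ n → ForcedDescent n)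
    (hN : MaxContactCut.CornerNormalFormAll) (hM : MaxContactCut.MonomialCornerAll) (hK : NoCornerTowers)
    (hC : MaxContactCut.CurveLawAll) (hL : MaxContactCut.SurfaceLawAll)
    (hS : MaxContactCut.NoSingularSurfaceHuggingTowers) (hH : MaxContactCut.NoHypersurfaceHuggingTowers)
    (hNI : MaxContactCut.NowhereIsolatedReduction) : MaxContactCut.RungOne :=
  MaxContactCutMonomialTowers.rungOne_of_pieces hSeed hDesc hN (noHuggingTowers_of_g11 hM hK hC hL hS hH) hNI

/-- **The located dim-4 core 28544 `MaxContactCut.StepPICoreDimFour` BY NAME** through the TREE kernel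
`core_of_pieces`. [folklore] -/
theorem core_of_g11 (hSeed : ∀ n : ℕ, 1 ≤ n → ForcedSeed n) (hDesc : ∀ n : ℕ, 1 ≤ n → ForcedDescent n)
    (hN : MaxContactCut.CornerNormalFormAll) (hM : MaxContactCut.MonomialCornerAll) (hK : NoCornerTowers)
    (hC : MaxContactCut.CurveLawAll) (hL : MaxContactCut.SurfaceLawAll)
    (hS : MaxContactCut.NoSingularSurfaceHuggingTowers) (hH : MaxContactCut.NoHypersurfaceHuggingTowers)
    (hNI : MaxContactCut.NowhereIsolatedReduction) (hStep : MaxContactCut.SequenceToStepAll) :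
    MaxContactCut.StepPICoreDimFour :=
  MaxContactCutMonomialTowers.core_of_pieces hSeed hDesc hN (noHuggingTowers_of_g11 hM hK hC hL hS hH) hNI hStep

end Summit.ResolutionOfSingularities.ResolutionOfSingularities.Theorems.MaxContactCutSurfaceShadow
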